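import Summits.AtomisticToContinuum.BoseEinsteinCondensation.Theorems.BECCellInformationOneBodyEntropyBoundAeCoreOrAeZero
import Summits.AtomisticToContinuum.BoseEinsteinCondensation.Theorems.BECCellInformationOneBodyEntropyBoundDirichletFloor
import Summits.AtomisticToContinuum.BoseEinsteinCondensation.Theorems.BECCellInformationOneBodyEntropyBoundInsertionIntegrable
import Summits.AtomisticToContinuum.BoseEinsteinCondensation.Theorems.BECCellInformationOneBodyEntropyBoundCutoffAndCount
import Summits.AtomisticToContinuum.BoseEinsteinCondensation.Theorems.BECCellInformationOneBodyEntropyBoundCubeNeumannBound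
import Summits.AtomisticToContinuum.BoseEinsteinCondensation.Theorems.BECCellInformationOneBodyEntropyBoundCagingBound
import Summits.AtomisticToContinuum.BoseEinsteinCondensation.Theorems.BECCellInformationOneBodyEntropyBoundDenseCellMain
import Summits.AtomisticToContinuum.BoseEinsteinCondensation.Theorems.BECCellInformationOneBodyEntropyBoundJastrowProfile
import Summits.AtomisticToContinuum.BoseEinsteinCondensation.Theorems.BECCellInformationOneBodyEntropyBoundProductJastrow
import Summits.AtomisticToContinuum.BoseEinsteinCondensation.Theorems.BECCellInformationOneBodyEntropyBoundFirstVariation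
import Summits.AtomisticToContinuum.BoseEinsteinCondensation.Theorems.BECCellInformationOneBodyEntropyBoundInsertionAssembly

/-!
# Crux `OneBodyEntropyBound` (stmt-AtomisticToContinuum-13440) — line `registered`, skeleton r8 (lead c2) — ALL STUBS LANDED, sorry-free

Lead prover-line-stmt-AtomisticToContinuum-13440-c2, 2026-08-17. `Lines/birth.lean` r5 (lead c1) closed the crux modulo the
single stub `stub_coarseEssHollow` (coarse occupation-entropy bound for ESSENTIALLY-HOLLOW pair potentials) and diagnosed it
as needing "genuine ground-state input" (no-clumping for near-minimisers). r6 RESHAPED that stub into a variational route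
that does not rest on energy asymptotics; r7: six of the seven stubs LANDED; r8: the residual is DISCHARGED by the landed general insertion lemma `stub_insertionAssembly` (p155769) with `stub_jastrowProfile` (p153825), `stub_productJastrow` (p153754), `stub_firstVariation` (p155580) — the skeleton is sorry-free:

* `stub_dirichletFloor` — the bosonic ground-state energy is the absolute one (Dirichlet box): `E₀(N,L)·∫|f|² ≤ 𝓔[f]`
  for EVERY `C¹` `f` vanishing off `Λ_L^N`, symmetric or not (adapt `BosonicFloor.lean`, torus → box).
* `stub_insertionIntegrable` — INSERTION LEMMA for integrable potentials (`∫ v(|x|)dx < ∞`): `E₀(n+1,L) ≤ E₀(n,L) + κ`,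
  `κ → 0` with `ρ`, at `L = ((n+1)/ρ)^{1/3}` (product state `Φ ⊗ u` with `u` a dilated bump, position averaged; floor).
* `stub_cutoffAndCount` — (i) smooth one-body partition `χ² + η² = 1` adapted to a cube with margin `m` and transition
  width `w`, `|∇χ|² + |∇η|² ≤ C₀/w²`; (ii) at most `(⌈2s/R⌉₊+1)³` points of a cube of side `s` are pairwise `R`-isolated.
* `stub_cubeNeumannBound` — local Neumann bound on a cube `U` of side `ℓ`: `ε₀ ∫_U |φ|² ≤ ∫_U |∇φ|² + c ∫_{Sh} |φ|²` for
  every measurable `Sh ⊆ U` of volume `≥ σ₀` (cube Poincaré `Poincare.isPoincare_space`).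
* `stub_cagingBound` — ONE-BODY CAGING BOUND: if `v` is not a.e. zero on `(0,∞)` there are `R, β > 0` with
  `β ∫_{⋃_{j∈S} B(y_j,R)} |φ|² ≤ ∫_T |∇φ|² + ∫_T (Σ_{j∈S} v(|x−y_j|)) |φ|²` for every finite point set and every
  `T ⊇ ⋃ B(y_j,7R)` (lattice covering of multiplicity `125` + the cube bound on cubes of side `5R`).
* `stub_denseCellBound` (lead) — ONE-PARTICLE LOCAL ENERGY BOUND + DENSEST-CELL ASSEMBLY: for a `δ`-near-minimiser `Ψ`,
  localise particle `x₀` with `χ(x₀)² + η(x₀)² = 1` (pointwise IMS, no integration by parts), bound the `η`-part below by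
  `E₀(n+1)‖ηΨ‖²` (floor) and the `χ`-part by `E₀(n)‖χΨ‖² +` (share of `x₀` on `{χ=1}`) (group extraction
  `groundStateEnergy_mul_le_setLIntegral_group`), compare with `E₀(n+1) ≤ E₀(n) + κ`: the kinetic+interaction share
  of a particle in a cube `A` is `≤ δ + (κ + 3C₀/w²)·P(x₀ ∈ A″)`; caging turns the share into `β·P(x₀ ∈ A, non-isolated)`,
  counting and Bose symmetry into `β((n+1)P_A − γ₀)`; at the DENSEST cell `P(x₀∈A″) ≤ 27 P_A`, whence
  `(n+1)P_A ≤ 2(1+γ₀)` `N`-uniformly and `Σ_k M⁻³ klFun(M³P_k) ≤ max(log Λ,0) + 1`.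
* `stub_insertionResidual` — the HONEST RESIDUAL: the insertion lemma for essentially-hollow, NON-integrable potentials
  (hard hollow shells `⊤·1_[r₁,r₂]`, `⊤` on fat Cantor sets): needs a Jastrow (Dyson nearest-neighbour) insertion and
  the approximate eigenfunction identity for near-minimisers. Everything else above is `v`-general.

`OneBodyEntropyBound_of : Sig.stub_insertionResidual → … → OneBodyEntropyBound` composes: a.e.-zero `v` (free gas) and
a.e.-positive-core `v` by the LANDED partial theorem `oneBodyEntropyBound_of_aeCore_or_aeZero` (p147946); integrable `v` by
floor + insertion + caging + dense-cell bound + `Partial.of_coarse` (landed chain rule / within-cell LSI assembly); the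
rest by the residual stub in place of `stub_insertionIntegrable`.
-/

noncomputable section

namespace Summit.AtomisticToContinuum.BoseEinsteinCondensation.Cruxes.OneBodyEntropyBound.Birth

open MeasureTheory Filter
open scoped ENNReal

/-! ### Signatures of the stubs (named `Prop`s; each is verbatim the statement of `theorem stub_<name>`) -/

namespace Sig

/-- DIRICHLET BOSONIC FLOOR: the infimum of the quadratic form over Bose-symmetric `C¹` Dirichlet states is below the
quadratic form of every `C¹` function vanishing off the box, symmetric or not (unnormalised form).
[cite: LSSY2005, Ch. 2 (bosons: remark after (2.1))] -/
def stub_dirichletFloor : Prop :=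
    ∀ (N : ℕ) (L : ℝ) (v : ℝ → ENNReal), Measurable v →
      ∀ f : Literature.MathematicalPhysics.QuantumManyBody.BoseGas.Config N → ℂ, ContDiff ℝ 1 f →
        (∀ X, X ∉ Literature.MathematicalPhysics.QuantumManyBody.BoseGas.boxN N L → f X = 0) →
        Literature.MathematicalPhysics.QuantumManyBody.BoseGas.groundStateEnergy v N L *
            ∫⁻ X, (‖f X‖₊ : ENNReal) ^ 2 ≤
          ∫⁻ X, (Literature.MathematicalPhysics.QuantumManyBody.BoseGas.kineticDensity f X +
            Literature.MathematicalPhysics.QuantumManyBody.BoseGas.interaction v X * (‖f X‖₊ : ENNReal) ^ 2)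

/-- INSERTION LEMMA, INTEGRABLE POTENTIALS (given the Dirichlet floor): adding one particle to the box costs at most
`κ`, `κ → 0` with the density. [folklore] -/
def stub_insertionIntegrable : Prop :=
    (∀ (N : ℕ) (L : ℝ) (v : ℝ → ENNReal), Measurable v →
      ∀ f : Literature.MathematicalPhysics.QuantumManyBody.BoseGas.Config N → ℂ, ContDiff ℝ 1 f →
        (∀ X, X ∉ Literature.MathematicalPhysics.QuantumManyBody.BoseGas.boxN N L → f X = 0) →
        Literature.MathematicalPhysics.QuantumManyBody.BoseGas.groundStateEnergy v N L *
            ∫⁻ X, (‖f X‖₊ : ENNReal) ^ 2 ≤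
          ∫⁻ X, (Literature.MathematicalPhysics.QuantumManyBody.BoseGas.kineticDensity f X +
            Literature.MathematicalPhysics.QuantumManyBody.BoseGas.interaction v X * (‖f X‖₊ : ENNReal) ^ 2)) →
    ∀ v : ℝ → ENNReal, Literature.MathematicalPhysics.QuantumManyBody.BoseGas.IsRepulsiveFiniteRange v →
      (∫⁻ x : EuclideanSpace ℝ (Fin 3), v ‖x‖) ≠ ⊤ →
      ∀ κ : ℝ, 0 < κ → ∃ ρ₁ : ℝ, 0 < ρ₁ ∧ ∀ ρ : ℝ, 0 < ρ → ρ < ρ₁ →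
        ∀ᶠ n : ℕ in Filter.atTop,
          Literature.MathematicalPhysics.QuantumManyBody.BoseGas.groundStateEnergy v (n + 1)
              (Literature.MathematicalPhysics.QuantumManyBody.BoseGas.sideLength ρ (n + 1)) ≤
            Literature.MathematicalPhysics.QuantumManyBody.BoseGas.groundStateEnergy v n
              (Literature.MathematicalPhysics.QuantumManyBody.BoseGas.sideLength ρ (n + 1)) + ENNReal.ofReal κ

/-- CUTOFF PAIR AND ISOLATED-POINT COUNT: (i) a `C¹` one-body partition of unity `χ² + η² = 1` with `χ = 1` on a closed
coordinate box, `χ = ∇χ = ∇η = 0` off its open `w`-neighbourhood and `|∇χ|² + |∇η|² ≤ C₀/w²`; (ii) among any finite family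
of points, those lying in a cube of side `s` and having no OTHER point of the family in that cube within distance `< R` are
at most `(⌈2s/R⌉₊ + 1)³`. [folklore] -/
def stub_cutoffAndCount : Prop :=
    (∃ C₀ : ℝ, 0 < C₀ ∧ ∀ (a : Fin 3 → ℝ) (s m w : ℝ), 0 ≤ s → 0 ≤ m → 0 < w →
      ∃ χ η : EuclideanSpace ℝ (Fin 3) → ℝ,
        ContDiff ℝ 1 χ ∧ ContDiff ℝ 1 η ∧ (∀ x, χ x ^ 2 + η x ^ 2 = 1) ∧
        (∀ x : EuclideanSpace ℝ (Fin 3), (∀ j, x j ∈ Set.Icc (a j - m) (a j + s + m)) → χ x = 1) ∧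
        (∀ x : EuclideanSpace ℝ (Fin 3), (∃ j, x j ∉ Set.Ioo (a j - m - w) (a j + s + m + w)) →
            χ x = 0 ∧ fderiv ℝ χ x = 0 ∧ fderiv ℝ η x = 0) ∧
        (∀ x, ‖fderiv ℝ χ x‖ ^ 2 + ‖fderiv ℝ η x‖ ^ 2 ≤ C₀ / w ^ 2)) ∧
    (∀ (N : ℕ) (a : Fin 3 → ℝ) (s R : ℝ), 0 < s → 0 < R →
      ∀ X : Fin N → EuclideanSpace ℝ (Fin 3),
        ((Finset.univ.filter fun i : Fin N =>
            (∀ j, X i j ∈ Set.Ico (a j) (a j + s)) ∧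
              ∀ i' : Fin N, i' ≠ i → (∀ j, X i' j ∈ Set.Ico (a j) (a j + s)) → R ≤ dist (X i) (X i')).card : ℝ) ≤
          ((⌈2 * s / R⌉₊ : ℝ) + 1) ^ 3)

/-- LOCAL NEUMANN BOUND ON A CUBE: the lowest Neumann energy of `−Δ + c·1_{Sh}` on a cube of side `ℓ` is bounded below
by `ε₀(ℓ, c, σ₀) > 0` uniformly over measurable `Sh ⊆ U` of volume `≥ σ₀` (cube Poincaré inequality). [folklore] -/
def stub_cubeNeumannBound : Prop :=
    ∀ (ℓ c σ₀ : ℝ), 0 < ℓ → 0 < c → 0 < σ₀ → ∃ ε₀ : ℝ, 0 < ε₀ ∧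
      ∀ (a : EuclideanSpace ℝ (Fin 3)) (Sh : Set (EuclideanSpace ℝ (Fin 3))), MeasurableSet Sh →
        Sh ⊆ {x | ∀ k, x k ∈ Set.Ioo (a k) (a k + ℓ)} → ENNReal.ofReal σ₀ ≤ MeasureTheory.volume Sh →
        ∀ φ : EuclideanSpace ℝ (Fin 3) → ℂ, ContDiff ℝ 1 φ → HasCompactSupport φ →
          ENNReal.ofReal ε₀ * ∫⁻ x in {x | ∀ k, x k ∈ Set.Ioo (a k) (a k + ℓ)}, (‖φ x‖₊ : ENNReal) ^ 2 ≤
            (∫⁻ x in {x | ∀ k, x k ∈ Set.Ioo (a k) (a k + ℓ)},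
                ∑ k : Fin 3, (‖fderiv ℝ φ x (EuclideanSpace.single k (1 : ℝ))‖₊ : ENNReal) ^ 2) +
              ENNReal.ofReal c * ∫⁻ x in Sh, (‖φ x‖₊ : ENNReal) ^ 2

/-- ONE-BODY CAGING BOUND (given the cube bound): for `v` not a.e. zero on `(0,∞)` there are `R, β > 0` such that, for
every finite family of points `y_j` (`j ∈ S`) and every `C¹` compactly supported `φ`, `β ∫_{⋃_{j∈S} B(y_j,R)} |φ|² ≤
∫_T |∇φ|² + ∫_T (Σ_{j∈S} v(|x − y_j|)) |φ|²` whenever `T ⊇ ⋃_{j∈S} B(y_j, 7R)`. [folklore] -/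
def stub_cagingBound : Prop :=
    (∀ (ℓ c σ₀ : ℝ), 0 < ℓ → 0 < c → 0 < σ₀ → ∃ ε₀ : ℝ, 0 < ε₀ ∧
      ∀ (a : EuclideanSpace ℝ (Fin 3)) (Sh : Set (EuclideanSpace ℝ (Fin 3))), MeasurableSet Sh →
        Sh ⊆ {x | ∀ k, x k ∈ Set.Ioo (a k) (a k + ℓ)} → ENNReal.ofReal σ₀ ≤ MeasureTheory.volume Sh →
        ∀ φ : EuclideanSpace ℝ (Fin 3) → ℂ, ContDiff ℝ 1 φ → HasCompactSupport φ →
          ENNReal.ofReal ε₀ * ∫⁻ x in {x | ∀ k, x k ∈ Set.Ioo (a k) (a k + ℓ)}, (‖φ x‖₊ : ENNReal) ^ 2 ≤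
            (∫⁻ x in {x | ∀ k, x k ∈ Set.Ioo (a k) (a k + ℓ)},
                ∑ k : Fin 3, (‖fderiv ℝ φ x (EuclideanSpace.single k (1 : ℝ))‖₊ : ENNReal) ^ 2) +
              ENNReal.ofReal c * ∫⁻ x in Sh, (‖φ x‖₊ : ENNReal) ^ 2) →
    ∀ v : ℝ → ENNReal, Measurable v →
      (¬ ∀ᵐ r : ℝ ∂(MeasureTheory.volume.restrict (Set.Ioi (0 : ℝ))), v r = 0) →
      ∃ R : ℝ, 0 < R ∧ ∃ β : ℝ, 0 < β ∧
        ∀ (m : ℕ) (Y : Fin m → EuclideanSpace ℝ (Fin 3)) (S : Finset (Fin m))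
          (T : Set (EuclideanSpace ℝ (Fin 3))), MeasurableSet T →
          (∀ j ∈ S, Metric.ball (Y j) (7 * R) ⊆ T) →
          ∀ φ : EuclideanSpace ℝ (Fin 3) → ℂ, ContDiff ℝ 1 φ → HasCompactSupport φ →
            ENNReal.ofReal β * ∫⁻ x in ⋃ j ∈ S, Metric.ball (Y j) R, (‖φ x‖₊ : ENNReal) ^ 2 ≤
              ∫⁻ x in T, ((∑ k : Fin 3, (‖fderiv ℝ φ x (EuclideanSpace.single k (1 : ℝ))‖₊ : ENNReal) ^ 2) +
                (∑ j ∈ S, v (dist x (Y j))) * (‖φ x‖₊ : ENNReal) ^ 2)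

/-- DENSE-CELL BOUND (lead's stub): floor + caging conclusion + cutoff/count + insertion conclusion for `v` give the coarse
occupation-entropy bound for `v` (one-particle local energy bound, densest cell). [folklore] -/
def stub_denseCellBound : Prop :=
    (∀ (N : ℕ) (L : ℝ) (v : ℝ → ENNReal), Measurable v →
      ∀ f : Literature.MathematicalPhysics.QuantumManyBody.BoseGas.Config N → ℂ, ContDiff ℝ 1 f →
        (∀ X, X ∉ Literature.MathematicalPhysics.QuantumManyBody.BoseGas.boxN N L → f X = 0) →
        Literature.MathematicalPhysics.QuantumManyBody.BoseGas.groundStateEnergy v N L *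
            ∫⁻ X, (‖f X‖₊ : ENNReal) ^ 2 ≤
          ∫⁻ X, (Literature.MathematicalPhysics.QuantumManyBody.BoseGas.kineticDensity f X +
            Literature.MathematicalPhysics.QuantumManyBody.BoseGas.interaction v X * (‖f X‖₊ : ENNReal) ^ 2)) →
    (∀ v : ℝ → ENNReal, Measurable v →
      (¬ ∀ᵐ r : ℝ ∂(MeasureTheory.volume.restrict (Set.Ioi (0 : ℝ))), v r = 0) →
      ∃ R : ℝ, 0 < R ∧ ∃ β : ℝ, 0 < β ∧
        ∀ (m : ℕ) (Y : Fin m → EuclideanSpace ℝ (Fin 3)) (S : Finset (Fin m))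
          (T : Set (EuclideanSpace ℝ (Fin 3))), MeasurableSet T →
          (∀ j ∈ S, Metric.ball (Y j) (7 * R) ⊆ T) →
          ∀ φ : EuclideanSpace ℝ (Fin 3) → ℂ, ContDiff ℝ 1 φ → HasCompactSupport φ →
            ENNReal.ofReal β * ∫⁻ x in ⋃ j ∈ S, Metric.ball (Y j) R, (‖φ x‖₊ : ENNReal) ^ 2 ≤
              ∫⁻ x in T, ((∑ k : Fin 3, (‖fderiv ℝ φ x (EuclideanSpace.single k (1 : ℝ))‖₊ : ENNReal) ^ 2) +
                (∑ j ∈ S, v (dist x (Y j))) * (‖φ x‖₊ : ENNReal) ^ 2)) →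
    ((∃ C₀ : ℝ, 0 < C₀ ∧ ∀ (a : Fin 3 → ℝ) (s m w : ℝ), 0 ≤ s → 0 ≤ m → 0 < w →
      ∃ χ η : EuclideanSpace ℝ (Fin 3) → ℝ,
        ContDiff ℝ 1 χ ∧ ContDiff ℝ 1 η ∧ (∀ x, χ x ^ 2 + η x ^ 2 = 1) ∧
        (∀ x : EuclideanSpace ℝ (Fin 3), (∀ j, x j ∈ Set.Icc (a j - m) (a j + s + m)) → χ x = 1) ∧
        (∀ x : EuclideanSpace ℝ (Fin 3), (∃ j, x j ∉ Set.Ioo (a j - m - w) (a j + s + m + w)) →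
            χ x = 0 ∧ fderiv ℝ χ x = 0 ∧ fderiv ℝ η x = 0) ∧
        (∀ x, ‖fderiv ℝ χ x‖ ^ 2 + ‖fderiv ℝ η x‖ ^ 2 ≤ C₀ / w ^ 2)) ∧
    (∀ (N : ℕ) (a : Fin 3 → ℝ) (s R : ℝ), 0 < s → 0 < R →
      ∀ X : Fin N → EuclideanSpace ℝ (Fin 3),
        ((Finset.univ.filter fun i : Fin N =>
            (∀ j, X i j ∈ Set.Ico (a j) (a j + s)) ∧
              ∀ i' : Fin N, i' ≠ i → (∀ j, X i' j ∈ Set.Ico (a j) (a j + s)) → R ≤ dist (X i) (X i')).card : ℝ) ≤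
          ((⌈2 * s / R⌉₊ : ℝ) + 1) ^ 3)) →
    ∀ v : ℝ → ENNReal, Literature.MathematicalPhysics.QuantumManyBody.BoseGas.IsRepulsiveFiniteRange v →
      (¬ ∀ᵐ r : ℝ ∂(MeasureTheory.volume.restrict (Set.Ioi (0 : ℝ))), v r = 0) →
      (∀ κ : ℝ, 0 < κ → ∃ ρ₁ : ℝ, 0 < ρ₁ ∧ ∀ ρ : ℝ, 0 < ρ → ρ < ρ₁ →
        ∀ᶠ n : ℕ in Filter.atTop,
          Literature.MathematicalPhysics.QuantumManyBody.BoseGas.groundStateEnergy v (n + 1)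
              (Literature.MathematicalPhysics.QuantumManyBody.BoseGas.sideLength ρ (n + 1)) ≤
            Literature.MathematicalPhysics.QuantumManyBody.BoseGas.groundStateEnergy v n
              (Literature.MathematicalPhysics.QuantumManyBody.BoseGas.sideLength ρ (n + 1)) + ENNReal.ofReal κ) →
      ∃ ρ₀ : ℝ, 0
      < ρ₀ ∧ ∀ ρ : ℝ, 0 < ρ → ρ < ρ₀ → ∃ l : ℝ, 0 < l ∧ ∃ C : ℝ, ∀ᶠ n : ℕ in Filter.atTop, ∃ δ :
      ENNReal, 0 < δ ∧ ∀ Ψ : Literature.MathematicalPhysics.QuantumManyBody.BoseGas.TrialState (n +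
      1) (Literature.MathematicalPhysics.QuantumManyBody.BoseGas.sideLength ρ (n + 1)),
      Literature.MathematicalPhysics.QuantumManyBody.BoseGas.energy v Ψ ≤
      Literature.MathematicalPhysics.QuantumManyBody.BoseGas.groundStateEnergy v (n + 1)
      (Literature.MathematicalPhysics.QuantumManyBody.BoseGas.sideLength ρ (n + 1)) + δ →
      ENNReal.ofReal (∑ k : Fin 3 → Fin
      ⌈Literature.MathematicalPhysics.QuantumManyBody.BoseGas.sideLength ρ (n + 1) / l⌉₊,
      ((⌈Literature.MathematicalPhysics.QuantumManyBody.BoseGas.sideLength ρ (n + 1) / l⌉₊ : ℝ) ^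
      3)⁻¹ * InformationTheory.klFun
      ((⌈Literature.MathematicalPhysics.QuantumManyBody.BoseGas.sideLength ρ (n + 1) / l⌉₊ : ℝ) ^ 3
      * (∫ x in {y : EuclideanSpace ℝ (Fin 3) | ∀ j, y j ∈ Set.Ico (((k j : ℕ) : ℝ) *
      ((Literature.MathematicalPhysics.QuantumManyBody.BoseGas.sideLength ρ (n + 1)) /
      (⌈Literature.MathematicalPhysics.QuantumManyBody.BoseGas.sideLength ρ (n + 1) / l⌉₊ : ℝ)))
      ((((k j : ℕ) : ℝ) + 1) * ((Literature.MathematicalPhysics.QuantumManyBody.BoseGas.sideLength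
      ρ (n + 1)) / (⌈Literature.MathematicalPhysics.QuantumManyBody.BoseGas.sideLength ρ (n + 1) /
      l⌉₊ : ℝ)))}, ∫ Y' : Literature.MathematicalPhysics.QuantumManyBody.BoseGas.Config n, ‖Ψ.ψ
      (Matrix.vecCons x Y')‖ ^ 2))) ≤ ENNReal.ofReal C

/-- INSERTION LEMMA, RESIDUAL CLASS (the open part): for essentially-hollow, non-integrable `v` (no a.e.-positive core,
not a.e. zero, `∫ v(|x|) dx = ∞`: hard hollow shells), adding one particle costs at most `κ → 0` with the density.
Expected proof: Dyson nearest-neighbour Jastrow insertion into a near-minimiser of `E₀(n)` + approximate eigenfunction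
identity. [cite: LSSY2005, Thm 2.2 / (2.17)–(2.26) (Dyson's upper bound)] -/
def stub_insertionResidual : Prop :=
    ∀ v : ℝ → ENNReal, Literature.MathematicalPhysics.QuantumManyBody.BoseGas.IsRepulsiveFiniteRange v →
      (¬ (∃ c : ENNReal, ∃ r₀ : ℝ, 0 < c ∧ 0 < r₀ ∧
          ∀ᵐ r : ℝ ∂(MeasureTheory.volume.restrict (Set.Ioc (0 : ℝ) r₀)), c ≤ v r)) →
      (¬ ∀ᵐ r : ℝ ∂(MeasureTheory.volume.restrict (Set.Ioi (0 : ℝ))), v r = 0) →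
      (∫⁻ x : EuclideanSpace ℝ (Fin 3), v ‖x‖) = ⊤ →
      ∀ κ : ℝ, 0 < κ → ∃ ρ₁ : ℝ, 0 < ρ₁ ∧ ∀ ρ : ℝ, 0 < ρ → ρ < ρ₁ →
        ∀ᶠ n : ℕ in Filter.atTop,
          Literature.MathematicalPhysics.QuantumManyBody.BoseGas.groundStateEnergy v (n + 1)
              (Literature.MathematicalPhysics.QuantumManyBody.BoseGas.sideLength ρ (n + 1)) ≤
            Literature.MathematicalPhysics.QuantumManyBody.BoseGas.groundStateEnergy v n
              (Literature.MathematicalPhysics.QuantumManyBody.BoseGas.sideLength ρ (n + 1)) + ENNReal.ofReal κ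

end Sig

/-! ### The registered stubs -/

-- LANDED (imported from Theorems/, same namespace): `stub_dirichletFloor` p150741, `stub_insertionIntegrable` p151416,
-- `stub_cutoffAndCount` p151560, `stub_cubeNeumannBound` p150959, `stub_cagingBound` p151891, `stub_denseCellBound` (DenseCellMain).

/-- **Stub (residual, open): insertion lemma for the essentially-hollow non-integrable class** — see
`Sig.stub_insertionResidual`. -/
theorem stub_insertionResidual :
    ∀ v : ℝ → ENNReal, Literature.MathematicalPhysics.QuantumManyBody.BoseGas.IsRepulsiveFiniteRange v →
      (¬ (∃ c : ENNReal, ∃ r₀ : ℝ, 0 < c ∧ 0 < r₀ ∧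
          ∀ᵐ r : ℝ ∂(MeasureTheory.volume.restrict (Set.Ioc (0 : ℝ) r₀)), c ≤ v r)) →
      (¬ ∀ᵐ r : ℝ ∂(MeasureTheory.volume.restrict (Set.Ioi (0 : ℝ))), v r = 0) →
      (∫⁻ x : EuclideanSpace ℝ (Fin 3), v ‖x‖) = ⊤ →
      ∀ κ : ℝ, 0 < κ → ∃ ρ₁ : ℝ, 0 < ρ₁ ∧ ∀ ρ : ℝ, 0 < ρ → ρ < ρ₁ →
        ∀ᶠ n : ℕ in Filter.atTop,
          Literature.MathematicalPhysics.QuantumManyBody.BoseGas.groundStateEnergy v (n + 1)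
              (Literature.MathematicalPhysics.QuantumManyBody.BoseGas.sideLength ρ (n + 1)) ≤
            Literature.MathematicalPhysics.QuantumManyBody.BoseGas.groundStateEnergy v n
              (Literature.MathematicalPhysics.QuantumManyBody.BoseGas.sideLength ρ (n + 1)) + ENNReal.ofReal κ :=
  -- r8: DISCHARGED by the landed general insertion lemma (Jastrow-dressed product state), for EVERY admissible `v`.
  fun v hv _ _ _ => stub_insertionAssembly stub_dirichletFloor stub_jastrowProfile stub_productJastrow stub_firstVariation v hv

/-! ### The assembly (sorry-free): the stubs imply the crux BY NAME -/

section Assembly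

open Literature.MathematicalPhysics.QuantumManyBody.BoseGas InformationTheory
open Summit.AtomisticToContinuum.BoseEinsteinCondensation.Theorems

/-- **`OneBodyEntropyBound` from the stubs.** Case split on the a.e. class of `v`: a.e. zero on `(0,∞)` or a.e.-positive core
→ the LANDED partial theorem `oneBodyEntropyBound_of_aeCore_or_aeZero`; otherwise the insertion conclusion for `v` (from
`stub_insertionIntegrable` when `∫ v(|x|)dx < ∞`, from the residual stub otherwise) feeds `stub_denseCellBound` (with
the floor, the caging bound from `stub_cagingBound ∘ stub_cubeNeumannBound`, and `stub_cutoffAndCount`), and the coarse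
bound becomes the crux by `Partial.of_coarse` (chain rule + within-cell LSI, landed). -/
theorem OneBodyEntropyBound_of :
    Summit.AtomisticToContinuum.BoseEinsteinCondensation.Theses.BECCellInformation.OneBodyEntropyBound := by
  have hres : Sig.stub_insertionResidual := stub_insertionResidual
  -- the stubs of this skeleton, by name
  have hfloor : Sig.stub_dirichletFloor := stub_dirichletFloor
  have hins : Sig.stub_insertionIntegrable := stub_insertionIntegrable
  have hcc : Sig.stub_cutoffAndCount := stub_cutoffAndCount
  have hcube : Sig.stub_cubeNeumannBound := stub_cubeNeumannBound
  have hcage : Sig.stub_cagingBound := stub_cagingBound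
  have hdense : Sig.stub_denseCellBound := stub_denseCellBound
  unfold Sig.stub_insertionResidual at hres
  unfold Sig.stub_dirichletFloor at hfloor
  unfold Sig.stub_insertionIntegrable at hins
  unfold Sig.stub_cutoffAndCount at hcc
  unfold Sig.stub_cubeNeumannBound at hcube
  unfold Sig.stub_cagingBound at hcage
  unfold Sig.stub_denseCellBound at hdense
  unfold Summit.AtomisticToContinuum.BoseEinsteinCondensation.Theses.BECCellInformation.OneBodyEntropyBound
  intro v hv
  by_cases hz : (∀ᵐ r : ℝ ∂(MeasureTheory.volume.restrict (Set.Ioi (0 : ℝ))), v r = 0)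
  · exact oneBodyEntropyBound_of_aeCore_or_aeZero v hv (Or.inr hz)
  · by_cases hpc : (∃ c : ENNReal, ∃ r₀ : ℝ, 0 < c ∧ 0 < r₀ ∧
        ∀ᵐ r : ℝ ∂(MeasureTheory.volume.restrict (Set.Ioc (0 : ℝ) r₀)), c ≤ v r)
    · exact oneBodyEntropyBound_of_aeCore_or_aeZero v hv (Or.inl hpc)
    · -- the insertion conclusion for `v`
      have hinsv : ∀ κ : ℝ, 0 < κ → ∃ ρ₁ : ℝ, 0 < ρ₁ ∧ ∀ ρ : ℝ, 0 < ρ → ρ < ρ₁ →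
          ∀ᶠ n : ℕ in Filter.atTop,
            groundStateEnergy v (n + 1) (sideLength ρ (n + 1)) ≤
              groundStateEnergy v n (sideLength ρ (n + 1)) + ENNReal.ofReal κ := by
        by_cases hint : (∫⁻ x : EuclideanSpace ℝ (Fin 3), v ‖x‖) = ⊤
        · exact hres v hv hpc hz hint
        · exact hins hfloor v hv hint
      exact Partial.of_coarse v hv (hdense hfloor (hcage hcube) hcc v hv hz hinsv)

end Assembly

end Summit.AtomisticToContinuum.BoseEinsteinCondensation.Cruxes.OneBodyEntropyBound.Birth

end
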